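/-
Copyright: the b2b-balaban cell (near-miss cell 7), T⁴-continuum fan-out; row NE7b ROUND-2 swarm, seat
t4-ne7b-formalise-leaf-02 (gen 6) — supplier piece for the S6g′ INSTANCE's T3b «injection» (owner's rulings
R-OWNER-22-23∕-24, holder leaf-05 g3): the births' reading and the recursion over all joins (journal OFFER
l.12803).  A supplier module consumed BY NAME; not a claim of T3b.  Released under the licence of the surrounding project.
-/
import Summits.QuantumFields.BalabanUV.T4Continuum.Support.HistoryJoinsGlue

/-!
# History joins, part 2″: the births' READING of a placement, and the REARRANGEMENT over all joins

Summits-side support leaf of the T⁴-continuum cell (rung (B)+1 on a FINITE torus only; NOT infinite volume, NOT the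
mass gap, NOT the Clay statement; NOT a proof of the spine estimate NE7b).  Row NE7b, route «COUNT», row S6g′
INSTANCE, piece T3b (R-OWNER-22-23), continued from part 2′ `HistoryJoinsGlue` (the inverse of `cfg`, the top-join
rearrangement `permTop`, `exists_glue_smul_mem_S`).  [folklore] finite tree surgery over the lineage's own carriers;
nothing is quoted from print, nothing printed is asserted, no `[cite:]` tag, no `Prop`-valued fact minted; the
definitions are a plain multiset-valued function (`bread`) and two predicates WITH parameters (`AllJoins` — leaf-05
g2's `CAdm` for a generic local predicate — and `PhysTop`, the order-free local datum), no named fact.  Imports part 2′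
only.

WHAT.
* §1 THE BIRTHS' READING **`bread c₀ G P : Multiset (ε × γ)`** — (birth label, datum read at the birth's address)
  over the births of `G`, WITH multiplicity (the shape of the owner's `PGen.pbirths`, R-OWNER-23-3); `bread_congr` (depends on `evalA c₀ P` on `baddr G`
  only), **`bread_eq_sum_clusterParts`** (shape of `HistoryJoins.bsum_eq_sum_clusterParts`),
  `bread_merge_eq_sum_parts`, **`sum_bread_smul`** (a class-preserving relabelling of the top join's parts does not
  change the sum of the parts' readings: equal keys = equal parts), **`bread_glue`**, **`bread_permTop`** — THE
  TOP-JOIN REARRANGEMENT READS THE SAME BIRTHS (T3b (ii): «the placed tree determines the member's births»; and what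
  makes a births-only zone, e.g. `regZoneD … (addrTag [] Z)` reading `{(b, P l)}`, blind to the tie-break),
  `ne_of_bread_ne`.
* §2 `AllJoins c₀ st L G P := ∀ q ∈ croots st G, L q.2 (rel c₀ q.1 P)` with `allJoins_born`, `allJoins_renew_iff`,
  **`allJoins_merge_iff`** (top ∧ parts, as `cadm_merge_iff`), `cadm_iff_allJoins` (`Iff.rfl`); the ORDER-FREE local
  datum **`PhysTop c₀ st zone (merge X Y e) P`** := the `touch0` graph of the placed parts reaches every part from
  the host ∧ two distinct parts of one class read different births (vacuous off mergers); and THE RECURSION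
  **`exists_rearranged_cadm`** ∕ **`exists_rearranged_mem_S`**: under the two DISPLAYED abstract hypotheses
  `hzone : Junk Z c₀ p → Junk Z c₀ p' → bread c₀ Z p = bread c₀ Z p' → evalA c₀ p (rootAddr Z) =
  evalA c₀ p' (rootAddr Z) → zone t Z p = zone t Z p'` (the zone reads the births and the root value only — as the
  instance's `HistoryJoinsPlacedZone.zoneP`, whose `OK` reads the tagged births and the root cell) and
  `hρ : Function.Injective ρ` (e.g. a linear order on placements), every junk placement `P` of a tree of depth `≤ D`
  with `AllJoins c₀ st (PhysTop c₀ st zone) G P` has a rearrangement `P'` that is junk, reads the same births, keeps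
  the root value and is canonically admissible — `P' ∈ S zone ρ c₀ st G (evalA c₀ P (rootAddr G))` (strong induction
  on `gsize` along `jparts`, part 2′'s `exists_glue_smul_mem_S` at every join).  §3 sanity.  §4 (v1.1)
  `length_lt_gsize_of_mem_baddr`, **`depth_le_of_gsize_le`**: the depth side condition `hD` holds for `D ≥ gsize G`.

HONEST SCOPE.  Abstract `zone`∕`ρ` under displayed hypotheses; whether the instance's `ρ` is injective and its zone
births-only is for the instance seat to decide (part 2′ §2 serves any `ρ`).  The binding to realised members
(placement value `γ′ = cell × template` of F-leaf05g3-2, realised contact ⇒ `PhysTop`, the template factor,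
injectivity on the slot's occupants) is T3b proper (its holder's), NOT here.  Nothing of H3∕(B)∕BetaPertH touched;
`BirthShapeNodup`∕`resum` NOT retired by this file; NE7b NOT proved; spine 0∕9.  HONEST DEPENDENCY (cell):
continuum YM on T⁴ ⇐ BetaPertH ∧ nine spine estimates (0/9 proved); BetaPertH ⇐ (D1) ∧ (D4) ∧ CAP+tail; G-an2-4
gates asym, D1 and NE2/3/4.  This file changes none of it.
-/

open Finset
open Literature.MathematicalPhysics.QuantumFieldTheory.Balaban1983to89
open T4PersistenceDictionary T4PartnerMultiplicity T4BranchingRecordsGas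
open Summit.QuantumFields.BalabanUV.T4Continuum.HistorySiblingSymmetry
open Summit.QuantumFields.BalabanUV.T4Continuum.HistorySiblingOrbits
open Summit.QuantumFields.BalabanUV.T4Continuum.HistorySiblingCanon
open Summit.QuantumFields.BalabanUV.T4Continuum.HistoryJoins
open Summit.QuantumFields.BalabanUV.T4Continuum.HistoryJoinsAdm
open Summit.QuantumFields.BalabanUV.T4Continuum.HistoryJoinsCount
open Summit.QuantumFields.BalabanUV.T4Continuum.HistoryJoinsGlue

namespace Summit.QuantumFields.BalabanUV.T4Continuum.HistoryJoinsRearrange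

noncomputable section

open scoped Classical

/-! ## §1 The births' reading of a placement and its invariance -/

section Bread

variable {ε γ : Type*} {D : ℕ} (c₀ : γ)

/-- **THE BIRTHS' READING** of a placement: the multiset of (birth label, datum read at the birth's address) over the
births of `G` — WITH multiplicity (equal sub-trees placed alike contribute twice). [folklore] -/
def bread : Gen ε → (Addr D → γ) → Multiset (ε × γ)
  | Gen.born b _, P => {(b, evalA c₀ P [])}
  | Gen.renew G _ _, P => bread G P
  | Gen.merge X Y _, P => bread X (rel c₀ [false] P) + bread Y (rel c₀ [true] P)

/-- the reading of a bare birth [folklore] -/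
@[simp] theorem bread_born (b : ε) (j : ℕ) (P : Addr D → γ) :
    bread c₀ (Gen.born b j) P = {(b, evalA c₀ P [])} := rfl

/-- renewals are transparent [folklore] -/
@[simp] theorem bread_renew (G : Gen ε) (e : ε) (h : ℕ) (P : Addr D → γ) :
    bread c₀ (Gen.renew G e h) P = bread c₀ G P := rfl

/-- the reading of a merger [folklore] -/
@[simp] theorem bread_merge (X Y : Gen ε) (e : ε) (P : Addr D → γ) :
    bread c₀ (Gen.merge X Y e) P = bread c₀ X (rel c₀ [false] P) + bread c₀ Y (rel c₀ [true] P) := rfl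

/-- **THE READING DEPENDS ON THE PLACEMENT ONLY THROUGH ITS VALUES AT THE BIRTH ADDRESSES.** [folklore] -/
theorem bread_congr : ∀ (G : Gen ε) {P P' : Addr D → γ},
    (∀ a ∈ baddr G, evalA c₀ P a = evalA c₀ P' a) → bread c₀ G P = bread c₀ G P'
  | Gen.born b j, P, P', h => by simp [h [] (by simp [baddr])]
  | Gen.renew G e k, P, P', h => bread_congr G h
  | Gen.merge X Y e, P, P', h => by
      simp only [bread_merge]
      rw [bread_congr X (P := rel c₀ [false] P) (P' := rel c₀ [false] P') fun a ha => ?_,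
        bread_congr Y (P := rel c₀ [true] P) (P' := rel c₀ [true] P') fun a ha => ?_]
      · rw [evalA_rel, evalA_rel]
        exact h _ (by simp only [baddr, mem_union, mem_image]; exact Or.inr ⟨a, ha, rfl⟩)
      · rw [evalA_rel, evalA_rel]
        exact h _ (by simp only [baddr, mem_union, mem_image]; exact Or.inl ⟨a, ha, rfl⟩)

/-- **THE READING DECOMPOSES ALONG THE CLUSTER PARTS** (shape of `HistoryJoins.bsum_eq_sum_clusterParts`). [folklore] -/
theorem bread_eq_sum_clusterParts (st : ε → ℕ) (t : ℕ) : ∀ (G : Gen ε) (P : Addr D → γ),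
    bread c₀ G P = ((clusterParts st t G).map fun q => bread c₀ q.2 (rel c₀ q.1 P)).sum
  | Gen.born b j, P => by simp
  | Gen.renew G e h, P => by simp
  | Gen.merge X Y e, P => by
      by_cases he : st e = t
      · rw [clusterParts_merge_of_eq st he, List.map_append, List.sum_append, List.map_map, List.map_map,
          bread_merge, bread_eq_sum_clusterParts st t X, bread_eq_sum_clusterParts st t Y]
        have h0 : ((fun q : List Bool × Gen ε => bread c₀ q.2 (rel c₀ q.1 P)) ∘
              fun q : List Bool × Gen ε => (false :: q.1, q.2)) =
            fun q : List Bool × Gen ε => bread c₀ q.2 (rel c₀ q.1 (rel c₀ [false] P)) := by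
          funext q
          simp only [Function.comp_apply]
          rw [← rel_append]
          rfl
        have h1 : ((fun q : List Bool × Gen ε => bread c₀ q.2 (rel c₀ q.1 P)) ∘
              fun q : List Bool × Gen ε => (true :: q.1, q.2)) =
            fun q : List Bool × Gen ε => bread c₀ q.2 (rel c₀ q.1 (rel c₀ [true] P)) := by
          funext q
          simp only [Function.comp_apply]
          rw [← rel_append]
          rfl
        rw [h0, h1]
      · rw [clusterParts_merge_of_ne st he]
        simp

/-- **THE READING OF A MERGER IS THE SUM OVER THE TOP JOIN'S PARTS** of the parts' readings of the relative placements
(a list sum is the sum over the indices: `List.ofFn_get`, `List.sum_ofFn`). [folklore] -/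
theorem bread_merge_eq_sum_parts (st : ε → ℕ) (X Y : Gen ε) (e : ε) (P : Addr D → γ) :
    bread c₀ (Gen.merge X Y e) P =
      ∑ i : Fin (npart st (Gen.merge X Y e)), bread c₀ (part st _ i).2 (cfg c₀ st X Y e P i) := by
  rw [bread_eq_sum_clusterParts c₀ st (st e)]
  have h : ∀ (l : List (List Bool × Gen ε)) (f : List Bool × Gen ε → Multiset (ε × γ)),
      (l.map f).sum = ∑ i : Fin l.length, f (l.get i) := fun l f => by
    conv_lhs => rw [← List.ofFn_get l, List.map_ofFn]
    rw [List.sum_ofFn]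
    rfl
  exact h _ _

/-- **A CLASS-PRESERVING RELABELLING DOES NOT CHANGE THE SUM OF THE PARTS' READINGS** (equal keys = equal parts).
[folklore] -/
theorem sum_bread_smul (st : ε → ℕ) (X Y : Gen ε) (e : ε) (σ : keyPerms (key st X Y e))
    (c : Fin (npart st (Gen.merge X Y e)) → (Addr D → γ)) :
    ∑ i, bread c₀ (part st _ i).2 ((σ • c) i) = ∑ i, bread c₀ (part st _ i).2 (c i) := by
  have h : ∀ i, bread c₀ (part st _ i).2 ((σ • c) i) =
      (fun j => bread c₀ (part st (Gen.merge X Y e) j).2 (c j)) ((σ : Equiv.Perm _).symm i) := fun i => by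
    simp only [smul_apply]
    rw [← part_eq_of_key_eq st X Y e (key_symm_apply σ i)]
  rw [Finset.sum_congr rfl fun i _ => h i]
  exact Equiv.sum_comp (σ : Equiv.Perm _).symm fun j => bread c₀ (part st (Gen.merge X Y e) j).2 (c j)

variable {c₀}

/-- **THE READING OF A GLUED PLACEMENT** is the sum of the parts' readings. [folklore] -/
theorem bread_glue {st : ε → ℕ} {X Y : Gen ε} {e : ε} (hD : ∀ a ∈ baddr (Gen.merge X Y e), a.length ≤ D)
    {c : Fin (npart st (Gen.merge X Y e)) → (Addr D → γ)} (hc : ∀ i, Junk (part st _ i).2 c₀ (c i)) :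
    bread c₀ (Gen.merge X Y e) (glue c₀ st X Y e c) = ∑ i, bread c₀ (part st _ i).2 (c i) := by
  rw [bread_merge_eq_sum_parts c₀ st, cfg_glue hD c hc]

/-- **THE TOP-JOIN REARRANGEMENT KEEPS THE BIRTHS' READING.** [folklore] -/
theorem bread_permTop {st : ε → ℕ} {X Y : Gen ε} {e : ε} (hD : ∀ a ∈ baddr (Gen.merge X Y e), a.length ≤ D)
    {P : Addr D → γ} (hJ : Junk (Gen.merge X Y e) c₀ P) (σ : keyPerms (key st X Y e)) :
    bread c₀ (Gen.merge X Y e) (permTop c₀ st X Y e σ P) = bread c₀ (Gen.merge X Y e) P := by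
  rw [permTop, bread_glue hD (junk_smul c₀ st X Y e (junk_cfg hJ) σ), sum_bread_smul, ← bread_merge_eq_sum_parts]

/-- placements with different readings are different [folklore] -/
theorem ne_of_bread_ne {G : Gen ε} {P P' : Addr D → γ} (h : bread c₀ G P ≠ bread c₀ G P') : P ≠ P' :=
  fun hPP => h (hPP ▸ rfl)

end Bread

/-! ## §2 A local predicate at every join; the order-free datum; the recursion over all joins -/

section AllJoins

variable {ε γ : Type*} {D : ℕ} (c₀ : γ) (st : ε → ℕ) (L : Gen ε → (Addr D → γ) → Prop)

/-- **A LOCAL PREDICATE AT EVERY JOIN** of `G`, read through the join's path (leaf-05 g2's `CAdm` is the case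
`L := LocalTop zone ρ c₀ st`, by `rfl`). [folklore] -/
def AllJoins (G : Gen ε) (P : Addr D → γ) : Prop := ∀ q ∈ croots st G, L q.2 (rel c₀ q.1 P)

/-- a bare birth has no join [folklore] -/
theorem allJoins_born (b : ε) (j : ℕ) (P : Addr D → γ) : AllJoins c₀ st L (Gen.born b j) P := by
  simp [AllJoins]

/-- a renewal has the joins of the renewed structure [folklore] -/
theorem allJoins_renew_iff (G : Gen ε) (e : ε) (h : ℕ) (P : Addr D → γ) :
    AllJoins c₀ st L (Gen.renew G e h) P ↔ AllJoins c₀ st L G P := by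
  simp [AllJoins]

/-- **A MERGER SATISFIES THE PREDICATE AT EVERY JOIN IFF IT DOES AT THE TOP AND ITS PARTS DO** (read through their
paths) — leaf-05 g2's `cadm_merge_iff` for a generic local predicate. [folklore] -/
theorem allJoins_merge_iff (X Y : Gen ε) (e : ε) (P : Addr D → γ) :
    AllJoins c₀ st L (Gen.merge X Y e) P ↔
      L (Gen.merge X Y e) P ∧ ∀ i, AllJoins c₀ st L (part st _ i).2 (cfg c₀ st X Y e P i) := by
  constructor
  · intro h
    refine ⟨?_, fun i q' hq' => ?_⟩
    · have := h ([], Gen.merge X Y e) ((mem_croots_merge_iff st X Y e _).2 (Or.inl rfl))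
      simpa using this
    · have hmem := (mem_croots_merge_iff st X Y e _).2 (Or.inr ⟨part st _ i, part_mem st _ i, q', hq', rfl⟩)
      have := h _ hmem
      simpa only [cfg, rel_append] using this
  · rintro ⟨htop, hparts⟩ q hq
    rcases (mem_croots_merge_iff st X Y e q).1 hq with rfl | ⟨p, hp, q', hq', rfl⟩
    · simpa using htop
    · obtain ⟨i, hi⟩ := exists_part_eq st hp
      have := hparts i q' (by rw [hi]; exact hq')
      simp only [cfg, hi] at this
      rw [rel_append]; exact this

variable {β R : Type*} [DecidableEq β] [LinearOrder R] (zone : ℕ → Gen ε → (Addr D → γ) → Finset β)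
  (ρ : (Addr D → γ) → R)

/-- canonical admissibility is the local join condition at every join [folklore] -/
theorem cadm_iff_allJoins (G : Gen ε) (P : Addr D → γ) :
    CAdm zone ρ c₀ st G P ↔ AllJoins c₀ st (LocalTop zone ρ c₀ st) G P := Iff.rfl

/-- **THE ORDER-FREE LOCAL DATUM** at the top join of a merger: the `touch0` graph of the PLACED parts («zones at the
join step share a block») reaches every part from the host, and two distinct parts of one class READ DIFFERENT BIRTHS;
vacuous elsewhere.  (What a realised member supplies: connected contact of the cluster, disjoint regions of distinct
sub-histories.) [folklore] -/
def PhysTop : Gen ε → (Addr D → γ) → Prop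
  | Gen.merge X Y e, P =>
      (∀ i, (SimpleGraph.fromRel fun i j =>
          touch0 zone st X Y e i (cfg c₀ st X Y e P i) j (cfg c₀ st X Y e P j)).Reachable (hostIdx st X Y e) i) ∧
        ∀ i j, key st X Y e i = key st X Y e j → i ≠ j →
          bread c₀ (part st _ i).2 (cfg c₀ st X Y e P i) ≠ bread c₀ (part st _ j).2 (cfg c₀ st X Y e P j)
  | _, _ => True

variable {c₀ st zone ρ}

/-- **THE RECURSION OVER ALL JOINS — A PHYSICALLY ADMISSIBLE PLACEMENT HAS A ρ-TIE-BROKEN REARRANGEMENT IN `S`.**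
Under two displayed abstract hypotheses — the zone map reads a junk placement only through its births' reading and
its root value (`hzone`), and the root read-out `ρ` is injective (any linear order on placements) — every junk
placement `P` of a tree `G` of depth `≤ D` satisfying the order-free datum `PhysTop` at every join has a rearrangement
`P'` that is junk, reads the same births, has the same root value, and is CANONICALLY ADMISSIBLE: `P' ∈ S zone ρ c₀ st
G (root value of P)`.  Strong induction on `gsize` along the top join's parts (`gsize_lt_of_mem_jparts`), part 2′ §2
at every join. [folklore] -/
theorem exists_rearranged_cadm [Fintype γ]
    (hzone : ∀ (t : ℕ) (Z : Gen ε) (p p' : Addr D → γ), Junk Z c₀ p → Junk Z c₀ p' →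
      bread c₀ Z p = bread c₀ Z p' → evalA c₀ p (rootAddr Z) = evalA c₀ p' (rootAddr Z) →
        zone t Z p = zone t Z p')
    (hρ : Function.Injective ρ) :
    ∀ (G : Gen ε) (P : Addr D → γ), (∀ a ∈ baddr G, a.length ≤ D) → Junk G c₀ P →
      AllJoins c₀ st (PhysTop c₀ st zone) G P →
        ∃ P' : Addr D → γ, Junk G c₀ P' ∧ bread c₀ G P' = bread c₀ G P ∧
          evalA c₀ P' (rootAddr G) = evalA c₀ P (rootAddr G) ∧ CAdm zone ρ c₀ st G P' := by
  suffices hmain : ∀ (n : ℕ) (G : Gen ε), gsize G = n → ∀ P : Addr D → γ, (∀ a ∈ baddr G, a.length ≤ D) →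
      Junk G c₀ P → AllJoins c₀ st (PhysTop c₀ st zone) G P →
        ∃ P' : Addr D → γ, Junk G c₀ P' ∧ bread c₀ G P' = bread c₀ G P ∧
          evalA c₀ P' (rootAddr G) = evalA c₀ P (rootAddr G) ∧ CAdm zone ρ c₀ st G P' from
    fun G P => hmain _ G rfl P
  intro n
  induction n using Nat.strong_induction_on with
  | _ n ih =>
    intro G hn P hD hJ hA
    cases G with
    | born b j => exact ⟨P, hJ, rfl, rfl, cadm_born zone ρ c₀ st b j P⟩
    | renew G₀ r k =>
        have hlt : gsize G₀ < n := by rw [← hn]; simp [gsize]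
        obtain ⟨P', hJ', hb, hr, hC⟩ := ih _ hlt G₀ rfl P hD hJ ((allJoins_renew_iff c₀ st _ G₀ r k P).1 hA)
        exact ⟨P', hJ', hb, hr, (cadm_renew zone ρ c₀ st G₀ r k P').2 hC⟩
    | merge X Y e =>
        obtain ⟨htop, hparts⟩ := (allJoins_merge_iff c₀ st _ X Y e P).1 hA
        obtain ⟨hconn, hdist⟩ :
            (∀ i, (SimpleGraph.fromRel fun i j =>
              touch0 zone st X Y e i (cfg c₀ st X Y e P i) j (cfg c₀ st X Y e P j)).Reachable (hostIdx st X Y e) i) ∧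
            ∀ i j, key st X Y e i = key st X Y e j → i ≠ j →
              bread c₀ (part st _ i).2 (cfg c₀ st X Y e P i) ≠ bread c₀ (part st _ j).2 (cfg c₀ st X Y e P j) :=
          htop
        -- the parts, by induction
        have hDi : ∀ i : Fin (npart st (Gen.merge X Y e)), ∀ a ∈ baddr (part st _ i).2, a.length ≤ D := by
          intro i a ha
          have := hD _ (append_mem_baddr st X Y e i ha)
          rw [List.length_append] at this
          omega
        have hJi : ∀ i, Junk (part st _ i).2 c₀ (cfg c₀ st X Y e P i) := junk_cfg hJ
        have ih' : ∀ i : Fin (npart st (Gen.merge X Y e)), ∃ p' : Addr D → γ, Junk (part st _ i).2 c₀ p' ∧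
            bread c₀ (part st _ i).2 p' = bread c₀ (part st _ i).2 (cfg c₀ st X Y e P i) ∧
              evalA c₀ p' (rootAddr (part st _ i).2) = evalA c₀ (cfg c₀ st X Y e P i) (rootAddr (part st _ i).2) ∧
                CAdm zone ρ c₀ st (part st _ i).2 p' := fun i =>
          ih _ (hn ▸ gsize_lt_of_mem_jparts st _ _ (part_mem st _ i)) _ rfl _ (hDi i) (hJi i) (hparts i)
        choose c' hc'J hc'b hc'r hc'C using ih'
        have hc'S : ∀ i, c' i ∈ Sany zone ρ c₀ st (part st _ i).2 := fun i => mem_Sany.2 ⟨hc'J i, hc'C i⟩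
        -- the top join: connectivity and distinct read-outs transfer to the rearranged parts
        have hz : ∀ i, zone (st e) (part st _ i).2 (c' i) = zone (st e) (part st _ i).2 (cfg c₀ st X Y e P i) :=
          fun i => hzone _ _ _ _ (hc'J i) (hJi i) (hc'b i) (hc'r i)
        have hconn' : ∀ i, (SimpleGraph.fromRel fun i j =>
            touch0 zone st X Y e i (c' i) j (c' j)).Reachable (hostIdx st X Y e) i := by
          have heq : (fun i j => touch0 zone st X Y e i (c' i) j (c' j)) =
              fun i j => touch0 zone st X Y e i (cfg c₀ st X Y e P i) j (cfg c₀ st X Y e P j) := by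
            funext i j
            simp only [touch0, hz]
          rw [heq]
          exact hconn
        have hρ' : RootInj (key st X Y e) ρ c' := by
          intro i j hk hρij
          by_contra hne
          have heq : c' i = c' j := hρ hρij
          apply hdist i j hk hne
          rw [← hc'b i, ← hc'b j, heq, part_eq_of_key_eq st X Y e hk]
        obtain ⟨σ, hh, -, hmem⟩ := exists_glue_smul_mem_S hD hc'S hconn' hρ'
        refine ⟨glue c₀ st X Y e (σ • c'), junk_glue _, ?_, ?_, (mem_S.1 hmem).2.1⟩
        · rw [bread_glue hD (junk_smul c₀ st X Y e hc'J σ), sum_bread_smul, bread_merge_eq_sum_parts c₀ st X Y e P]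
          exact Finset.sum_congr rfl fun i _ => hc'b i
        · rw [evalA_glue_rootAddr hD, hh, hc'r, evalA_cfg_host]

/-- **… HENCE A MEMBER OF THE COUNTED SET** `S zone ρ c₀ st G (evalA c₀ P (rootAddr G))` reading the same births.
[folklore] -/
theorem exists_rearranged_mem_S [Fintype γ]
    (hzone : ∀ (t : ℕ) (Z : Gen ε) (p p' : Addr D → γ), Junk Z c₀ p → Junk Z c₀ p' →
      bread c₀ Z p = bread c₀ Z p' → evalA c₀ p (rootAddr Z) = evalA c₀ p' (rootAddr Z) →
        zone t Z p = zone t Z p')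
    (hρ : Function.Injective ρ) {G : Gen ε} {P : Addr D → γ} (hD : ∀ a ∈ baddr G, a.length ≤ D)
    (hJ : Junk G c₀ P) (hA : AllJoins c₀ st (PhysTop c₀ st zone) G P) :
    ∃ P' : Addr D → γ, bread c₀ G P' = bread c₀ G P ∧ P' ∈ S zone ρ c₀ st G (evalA c₀ P (rootAddr G)) := by
  obtain ⟨P', hJ', hb, hr, hC⟩ := exists_rearranged_cadm hzone hρ G P hD hJ hA
  exact ⟨P', hb, mem_S.2 ⟨hJ', hC, hr⟩⟩

end AllJoins

/-! ## §3 Sanity -/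

namespace Sanity

/-- a merger of two EQUAL-shape births: its reading under any placement lists both births' data whatever the order
of the parts — swapping the two relative placements does not change the multiset -/
example (P : Addr 1 → ℕ) :
    bread 0 (Gen.merge (Gen.born () 3) (Gen.born () 3) ()) P =
      {((), evalA 0 P [true])} + {((), evalA 0 P [false])} := by
  rw [bread_merge, bread_born, bread_born, add_comm]
  simp [evalA_rel]

end Sanity

/-! ## §4 The depth side condition `hD` is met with `D := gsize G` (v1.1, append-only) -/

section Depth

variable {ε : Type*}

/-- **BIRTH ADDRESSES ARE SHORTER THAN THE TREE IS BIG**: `a ∈ baddr G → a.length < gsize G`. [folklore] -/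
theorem length_lt_gsize_of_mem_baddr : ∀ (G : Gen ε) (a : List Bool), a ∈ baddr G → a.length < gsize G
  | Gen.born b j, a, h => by
      simp only [baddr, Finset.mem_singleton] at h
      simp [h, gsize]
  | Gen.renew G e k, a, h => (length_lt_gsize_of_mem_baddr G a h).trans (by simp [gsize])
  | Gen.merge X Y e, a, h => by
      simp only [baddr, Finset.mem_union, Finset.mem_image] at h
      rcases h with ⟨r, hr, rfl⟩ | ⟨r, hr, rfl⟩
      · have := length_lt_gsize_of_mem_baddr X r hr
        simp only [List.length_cons, gsize]
        omega
      · have := length_lt_gsize_of_mem_baddr Y r hr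
        simp only [List.length_cons, gsize]
        omega

/-- **THE DEPTH SIDE CONDITION `hD` OF PARTS 2′∕2″ HOLDS FOR EVERY `D ≥ gsize G`** (so a consumer may take
`D := gsize G`, or any uniform bound on the sizes of the trees of its slot family). [folklore] -/
theorem depth_le_of_gsize_le {G : Gen ε} {D : ℕ} (hG : gsize G ≤ D) : ∀ a ∈ baddr G, a.length ≤ D :=
  fun a ha => ((length_lt_gsize_of_mem_baddr G a ha).le).trans hG

end Depth

end

end Summit.QuantumFields.BalabanUV.T4Continuum.HistoryJoinsRearrange
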